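/-
Copyright (c) 2026 the pub-hodgecm-mathlib formalisation cell (harness21).  Prover seat hodgecm-mathlib-R90-C131-p05 (g0), HCML SLAB R90-TF,
section S4 «Ch. 13.1–2» (dealer K2E2-plan (g6)), ROAD «KEYS2-ANALYTIC» (MEMO `R90/R90-C131-p05/g0/MEMO-KEYS2-analytic-road.v1.md`), brick (ε1)
«U(Φ₂) BIG CELL», FILE A (factorisation + exact cell function).  2026-09-04/05.
-/
import Summits.HodgeConjecture.HodgeConjecture.Theorems.F0P3cStCharTSBigCellFactorisation     -- ★ (N = 3 twin): `neg_one_mem_normOneUnits` (generic `σ`)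
import Summits.HodgeConjecture.HodgeConjecture.Theorems.F0P3cU2PrincipalSeriesOpenCellTorusChar  -- ★ N = 2 kit: `exists_weylElt_two`; brings ★ LineRing chart, ★ `rootDeltaChar_cmBorel_torus_two`
import Literature.NumberTheory.Automorphic.CMPrincipalSeriesSpherical                             -- ★ `coe_torusEntry_proj_borelTriple`, `val_proj_borelTriple`
import Literature.NumberTheory.Automorphic.JacquetModuleFrobeniusProofs                          -- ★ `rootDeltaChar_eq_rootDeltaChar_inclusion_proj`
import Literature.NumberTheory.Automorphic.JacquetNonzeroEmbedsNormalizedInd                      -- ★ `deltaChar_cmBorelTriple_eq_one_of_mem_N`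
import HarnessLib

/-!
# R90-TF · S4 — ROAD «KEYS2-ANALYTIC», brick (ε1) «U(Φ₂) BIG CELL»: `w₀ · n(b) = U · (w₀ n(b⁻¹) w₀⁻¹)` with `U = [[−b⁻¹, 1],[0, b]] ∈ B₂`, the EXACT cell
# function `f(w₀ n(b)) = χ₁(σ b)⁻¹ · χ₂(−1) · ‖b‖^{-1/2} · f(w₀ n(b⁻¹) w₀⁻¹)` of every `f ∈ i_{U(Φ₂)}((χ₁, χ₂))`, and FAR OUT `f(w₀ n(b)) = (…) · f(1)`

Cell `hodgecm-mathlib`, crux H413 (`stmt-HodgeConjecture-24833`, lane `--supports … --as helper`), route of record `HCCMUnconditional` (no route verbs;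
count-neutral).  Programme R90-TF, section S4 (Rogawski Ch. 13.1–2, base `R90-C131`); seat R90-C131-p05 (g0).  THEOREMS ONLY (no `def`, no instance,
no notation, no named fact, no `sorry`); imports ★ only.  The `N = 2` twin of ★ `F0P3cStCharTSBigCellFactorisation` + ★ `F0P3cStCharTSCellFunFarOut` (the
`U(Φ₃)` big cell of the road «KEYS3-ANALYTIC»), on the way to (RED) = sub-sub-socket `stub_R90_S4_U2_ldsRed` of `Lines/R90_S4_HPacketsU2B.lean`.

THE MATHEMATICS ([Rogawski1990, §1.10, §11.1, §12.1]; [Casselman1995, Prop. 1.3.3, §6.4]).  `R` a commutative ring with involution `σ`, `Φ₂ = antidiag(1, 1)`,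
`G = U(σ, Φ₂)(R) ⊃ B₂ = T₂ N₂`, `N₂ = {n(y) = [[1, y],[0, 1]] : σ y = −y}`, `w₀ ∈ G` the element of matrix `Φ₂` (`w₀² = 1`).  For `u = n(b) ∈ N₂` with `b` a unit
and `u′ = n(b⁻¹)` (again in `N₂`: `b⁻¹` is skew):
  `w₀ n(b) = [[0, 1],[1, b]] = [[−b⁻¹, 1],[0, b]] · [[1, 0],[b⁻¹, 1]] = U · (w₀ u′ w₀⁻¹)`,
`U ∈ B₂` with `U₀₀ = −b⁻¹ = σ(b)⁻¹`, `det U = −1`.  Hence for a section `f` of `i(χ₁, χ₂) = Ind_{B₂}^G((χ₁, χ₂) δ^{1/2})` (`χ(diag(d₀, d₁)) = χ₁(d₀) χ₂(d₀ d₁)`,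
`δ_{B₂}^{1/2}(p) = ‖p₀₀‖^{1/2}` ★ `rootDeltaChar_cmBorel_torus_two`):
  `f(w₀ u) = χ₁(σ b)⁻¹ · χ₂(−1) · ‖b‖^{-1/2} · f(w₀ u′ w₀⁻¹)`,
and since `f` is a smooth vector and `w₀ u′ w₀⁻¹ → 1` as `‖b‖ → ∞` (`v` non-split: one place `w ∣ v`, `|b⁻¹|_w → 0`), FAR OUT `f(w₀ u) = (χ₁(σ b)⁻¹ χ₂(−1) ‖b‖^{-1/2}) · f(1)`.
* §1 (generic ring) `val_coe_unipotentU_two`, `val_weylElt_two`, `val_weylConj_unipotent_two`, `val_upperFactor_two`,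
  `upperFactor_mem_borelU_two`, `coe_diagEntry_zero_upperFactor_two`, `coe_diagEntry_one_upperFactor_two`.
* §2 (CM carrier) `toFun_weylElt_mul_eq_of_isUnit_two` — the exact cell function.
* FILE B `R90S4Keys2CellFunFarOut` (CM, `v` non-split): `exists_unipotent_entry_eq_inv_two`, `weylConj_mem_of_le_valued_two`, `exists_toFun_weylElt_mul_eq_mul_toFun_one_two` (far out).
HONEST LABEL: HC_CM is proved only modulo the 7 printed citations (2 remaining named inputs: hLiu418 = stmt-HodgeConjecture-24832,
h413 = stmt-HodgeConjecture-24833) until rung 0 closes; organ-level computation, closes nothing by itself; count-neutral.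

## References
* [Rogawski1990] J. D. Rogawski, *Automorphic Representations of Unitary Groups in Three Variables*, Ann. of Math. Stud. 123 (1990), §1.10 p. 9, §11.1 p. 161,
  §12.1 p. 171.
* [Casselman1995] W. Casselman, *Introduction to the theory of admissible representations of 𝔭-adic reductive groups* (1995), Prop. 1.3.3, §6.4.
* [Keys1984] D. Keys, *Principal series representations of special unitary groups over local fields*, Compositio Math. 51 (1984), §3, §7.
-/

set_option autoImplicit false
-- the mandated namespace (brief §3.4) repeats the single-problem summit's segment (`HodgeConjecture.HodgeConjecture`)
set_option linter.dupNamespace false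

noncomputable section

open NumberField IsDedekindDomain MeasureTheory
open scoped Matrix MatrixGroups NNReal
open Literature.NumberTheory.Automorphic Literature.NumberTheory.Automorphic.UnitaryGroup
open Summit.HodgeConjecture.HodgeConjecture.Cruxes.H413.F0P3cStCharTSBigCellFactorisation (neg_one_mem_normOneUnits)

namespace Summit.HodgeConjecture.HodgeConjecture.R90.S4

/-! ## §1 Generic ring: the big-cell factorisation inside `U(σ, Φ₂)(R)` -/

section Generic

variable {R : Type*} [CommRing R] (σ : R →+* R) {J : Matrix (Fin 2) (Fin 2) R} (hJ : J = (StdForm.antidiagonal 2).over R)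
  (w₀ : ↥(unitaryGroupOfForm σ J)) (hw₀ : ((w₀ : GL (Fin 2) R) : Matrix (Fin 2) (Fin 2) R) = J)

/-- **The matrix of `u ∈ N₂`** is `[[1, y],[0, 1]]` with `y = u₀₁` (★ `LineRing.umat_shape_two`). [cite: Rogawski1990, §1.10 p. 9] -/
theorem val_coe_unipotentU_two (u : ↥(unipotentU σ J)) :
    ((u : ↥(unitaryGroupOfForm σ J)) : GL (Fin 2) R).val =
      !![1, (((u : ↥(unitaryGroupOfForm σ J)) : GL (Fin 2) R) : Matrix (Fin 2) (Fin 2) R) 0 1; 0, 1] := by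
  obtain ⟨h10, h00, h11⟩ := LineRing.umat_shape_two σ u
  ext i j
  fin_cases i <;> fin_cases j
  · exact h00
  · rfl
  · exact h10
  · exact h11

include hJ hw₀ in
/-- The matrix of `w₀` is `Φ₂ = antidiag(1, 1)` as an explicit `2 × 2` matrix. [cite: Rogawski1990, §1.10 p. 9] -/
theorem val_weylElt_two : ((w₀ : GL (Fin 2) R) : Matrix (Fin 2) (Fin 2) R) = !![0, 1; 1, 0] := by
  rw [hw₀, hJ]
  ext i j
  simp only [StdForm.over, StdForm.antidiagonal, Matrix.map_apply, Matrix.of_apply]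
  fin_cases i <;> fin_cases j <;> simp

include hJ hw₀ in
/-- **The matrix of `w₀ u′ w₀⁻¹ ∈ N̄₂ = w₀ N₂ w₀⁻¹`** is lower unitriangular `[[1, 0],[u′₀₁, 1]]` (`w₀⁻¹ = w₀` as `Φ₂² = 1`, cf. ★ `weylElt₂_inv` on the CM carrier).
[cite: Casselman1995, Prop. 1.3.3] [cite: Rogawski1990, §1.10 p. 9] -/
theorem val_weylConj_unipotent_two (u' : ↥(unipotentU σ J)) :
    ((w₀ * (u' : ↥(unitaryGroupOfForm σ J)) * w₀⁻¹ : ↥(unitaryGroupOfForm σ J)) : GL (Fin 2) R).val =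
      !![1, 0; (((u' : ↥(unitaryGroupOfForm σ J)) : GL (Fin 2) R) : Matrix (Fin 2) (Fin 2) R) 0 1, 1] := by
  -- `w₀⁻¹ = w₀` (`Φ₂² = 1`)
  have hinv : w₀⁻¹ = w₀ := by
    refine inv_eq_of_mul_eq_one_right (Subtype.ext (Units.ext ?_))
    rw [Subgroup.coe_mul, Units.val_mul, val_weylElt_two σ hJ w₀ hw₀, Subgroup.coe_one, Units.val_one]
    ext i j
    fin_cases i <;> fin_cases j <;> simp
  rw [hinv, Subgroup.coe_mul, Subgroup.coe_mul, Units.val_mul, Units.val_mul,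
    val_coe_unipotentU_two σ u', val_weylElt_two σ hJ w₀ hw₀]
  ext i j
  fin_cases i <;> fin_cases j <;> simp [Matrix.mul_apply, Fin.sum_univ_two]

include hJ hw₀ in
/-- **THE BIG-CELL FACTORISATION INSIDE `U(σ, Φ₂)(R)` — the matrix of the upper factor `U := w₀ · u · (w₀ u′ w₀⁻¹)⁻¹`** is `[[−b⁻¹, 1],[0, b]]` when `u₀₁ = b` is a
unit and `u′₀₁ = b⁻¹`: `[[0, 1],[1, b]] · [[1, 0],[−b⁻¹, 1]] = [[−b⁻¹, 1],[0, b]]`. [cite: Casselman1995, Prop. 1.3.3] [cite: Rogawski1990, §1.10 p. 9] -/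
theorem val_upperFactor_two (u u' : ↥(unipotentU σ J)) (b : Rˣ)
    (hbu : (((u : ↥(unitaryGroupOfForm σ J)) : GL (Fin 2) R) : Matrix (Fin 2) (Fin 2) R) 0 1 = b)
    (h1 : (((u' : ↥(unitaryGroupOfForm σ J)) : GL (Fin 2) R) : Matrix (Fin 2) (Fin 2) R) 0 1 = ↑b⁻¹) :
    ((w₀ * (u : ↥(unitaryGroupOfForm σ J)) * (w₀ * (u' : ↥(unitaryGroupOfForm σ J)) * w₀⁻¹)⁻¹ : ↥(unitaryGroupOfForm σ J)) : GL (Fin 2) R).val =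
      !![-(↑b⁻¹ : R), 1; 0, (b : R)] := by
  -- `(w₀ u′ w₀⁻¹)⁻¹ = w₀ u′⁻¹ w₀⁻¹` and `(u′⁻¹)₀₁ = −b⁻¹`
  have hinv : (w₀ * (u' : ↥(unitaryGroupOfForm σ J)) * w₀⁻¹)⁻¹ = w₀ * ((u'⁻¹ : ↥(unipotentU σ J)) : ↥(unitaryGroupOfForm σ J)) * w₀⁻¹ := by
    rw [mul_inv_rev, mul_inv_rev, inv_inv, Subgroup.coe_inv, mul_assoc]
  have h1' : ((((u'⁻¹ : ↥(unipotentU σ J)) : ↥(unitaryGroupOfForm σ J)) : GL (Fin 2) R) : Matrix (Fin 2) (Fin 2) R) 0 1 = -(↑b⁻¹ : R) := by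
    rw [LineRing.umat_inv_zero_one_two, h1]
  have hL : ((w₀ * ((u'⁻¹ : ↥(unipotentU σ J)) : ↥(unitaryGroupOfForm σ J)) * w₀⁻¹ : ↥(unitaryGroupOfForm σ J)) : GL (Fin 2) R).val =
      !![1, 0; -(↑b⁻¹ : R), 1] := by
    rw [val_weylConj_unipotent_two σ hJ w₀ hw₀ u'⁻¹, h1']
  have hu : ((u : ↥(unitaryGroupOfForm σ J)) : GL (Fin 2) R).val = !![1, (b : R); 0, 1] := by
    rw [val_coe_unipotentU_two σ u, hbu]
  rw [hinv, Subgroup.coe_mul, Units.val_mul, hL, Subgroup.coe_mul, Units.val_mul, val_weylElt_two σ hJ w₀ hw₀, hu]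
  ext i j
  fin_cases i <;> fin_cases j <;> simp [Matrix.mul_apply, Fin.sum_univ_two]

include hJ hw₀ in
/-- **`U := w₀ · u · (w₀ u′ w₀⁻¹)⁻¹` lies in the Borel subgroup `B₂`** (its matrix is upper triangular). [cite: Casselman1995, Prop. 1.3.3] [cite: Rogawski1990, §1.10 p. 9] -/
theorem upperFactor_mem_borelU_two (u u' : ↥(unipotentU σ J)) (b : Rˣ)
    (hbu : (((u : ↥(unitaryGroupOfForm σ J)) : GL (Fin 2) R) : Matrix (Fin 2) (Fin 2) R) 0 1 = b)
    (h1 : (((u' : ↥(unitaryGroupOfForm σ J)) : GL (Fin 2) R) : Matrix (Fin 2) (Fin 2) R) 0 1 = ↑b⁻¹) :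
    w₀ * (u : ↥(unitaryGroupOfForm σ J)) * (w₀ * (u' : ↥(unitaryGroupOfForm σ J)) * w₀⁻¹)⁻¹ ∈ borelU σ J := by
  rw [mem_borelU_iff]
  intro i j hij
  change ((w₀ * (u : ↥(unitaryGroupOfForm σ J)) * (w₀ * (u' : ↥(unitaryGroupOfForm σ J)) * w₀⁻¹)⁻¹ : ↥(unitaryGroupOfForm σ J)) : GL (Fin 2) R).val i j = 0
  rw [val_upperFactor_two σ hJ w₀ hw₀ u u' b hbu h1]
  fin_cases i <;> fin_cases j <;> simp_all

include hJ hw₀ in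
/-- **`U₀₀ = −b⁻¹`** (★ `diagEntry`, the coordinate read by `χ₁` and by `δ_{B₂}^{1/2}`). [cite: Rogawski1990, §1.10 p. 9; §12.1 p. 171] -/
theorem coe_diagEntry_zero_upperFactor_two (u u' : ↥(unipotentU σ J)) (b : Rˣ)
    (hbu : (((u : ↥(unitaryGroupOfForm σ J)) : GL (Fin 2) R) : Matrix (Fin 2) (Fin 2) R) 0 1 = b)
    (h1 : (((u' : ↥(unitaryGroupOfForm σ J)) : GL (Fin 2) R) : Matrix (Fin 2) (Fin 2) R) 0 1 = ↑b⁻¹)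
    (hU : w₀ * (u : ↥(unitaryGroupOfForm σ J)) * (w₀ * (u' : ↥(unitaryGroupOfForm σ J)) * w₀⁻¹)⁻¹ ∈ borelU σ J) :
    ((diagEntry σ J 0 ⟨_, hU⟩ : Rˣ) : R) = -(↑b⁻¹ : R) := by
  rw [coe_diagEntry]
  change ((w₀ * (u : ↥(unitaryGroupOfForm σ J)) * (w₀ * (u' : ↥(unitaryGroupOfForm σ J)) * w₀⁻¹)⁻¹ : ↥(unitaryGroupOfForm σ J)) : GL (Fin 2) R).val 0 0 = _
  rw [val_upperFactor_two σ hJ w₀ hw₀ u u' b hbu h1]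
  rfl

include hJ hw₀ in
/-- **`U₁₁ = b`**. [cite: Rogawski1990, §1.10 p. 9] -/
theorem coe_diagEntry_one_upperFactor_two (u u' : ↥(unipotentU σ J)) (b : Rˣ)
    (hbu : (((u : ↥(unitaryGroupOfForm σ J)) : GL (Fin 2) R) : Matrix (Fin 2) (Fin 2) R) 0 1 = b)
    (h1 : (((u' : ↥(unitaryGroupOfForm σ J)) : GL (Fin 2) R) : Matrix (Fin 2) (Fin 2) R) 0 1 = ↑b⁻¹)
    (hU : w₀ * (u : ↥(unitaryGroupOfForm σ J)) * (w₀ * (u' : ↥(unitaryGroupOfForm σ J)) * w₀⁻¹)⁻¹ ∈ borelU σ J) :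
    ((diagEntry σ J 1 ⟨_, hU⟩ : Rˣ) : R) = (b : R) := by
  rw [coe_diagEntry]
  change ((w₀ * (u : ↥(unitaryGroupOfForm σ J)) * (w₀ * (u' : ↥(unitaryGroupOfForm σ J)) * w₀⁻¹)⁻¹ : ↥(unitaryGroupOfForm σ J)) : GL (Fin 2) R).val 1 1 = _
  rw [val_upperFactor_two σ hJ w₀ hw₀ u u' b hbu h1]
  rfl

end Generic

/-! ## §2 The CM carrier `R = ∏_{w ∣ v} L_w`, `σ = c ⊗ 1`, `J = cmLocalForm L 2 v`: the EXACT cell function on the big cell -/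

section CM

variable (L : Type) [Field L] [NumberField L] [IsCMField L] (v : HeightOneSpectrum (𝓞 ↥(maximalRealSubfield L)))
  (χ₁ : (LocalRing L v)ˣ →* ℂˣ) (χ₂ : ↥(normOneUnits (conjLocal L (IsCMField.complexConj L) v)) →* ℂˣ)
  (w₀ : ↥(unitaryGroupOfForm (conjLocal L (IsCMField.complexConj L) v) (cmLocalForm L 2 v)))
  (hw₀ : Units.val (w₀ : GL (Fin 2) (LocalRing L v)) = cmLocalForm L 2 v)

set_option synthInstance.maxHeartbeats 400000 in
set_option maxHeartbeats 1600000 in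
-- statement over the `SmoothInd` carrier of ★ `cmPrincipalSeries` (class of ★ `F0P3cU2PrincipalSeriesOpenCellTorusChar`)
include hw₀ in
/-- **THE CELL FUNCTION ON THE BIG CELL OF `U(Φ₂)(L⁺_v)`, EXACT FORM**: for every `f` in the `SmoothInd` carrier of ★ `cmPrincipalSeries L 2 v ((χ₁, χ₂))`
(`f(p g) = χ(proj p) δ_{B₂}^{1/2}(p) f(g)`, `χ = torusCharPair … 0 χ₁ χ₂`), every `u ∈ N₂` whose entry `b = u₀₁` is a unit and `u′ ∈ N₂` with `u′₀₁ = b⁻¹`: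
  `f(w₀ u) = χ₁(σ b)⁻¹ · χ₂(−1) · ‖b‖^{-1/2} · f(w₀ u′ w₀⁻¹)`
(`χ(proj U) = χ₁(U₀₀) χ₂(det U)`, `U₀₀ = −b⁻¹ = σ(b)⁻¹` as `σ b = −b` ★ `LineRing.map_umat_zero_one_two`, `det U = −1`; `δ_{B₂}^{1/2}(U) = ‖U₀₀‖^{1/2} = ‖b‖^{-1/2}` by ★
`rootDeltaChar_eq_rootDeltaChar_inclusion_proj`, ★ `rootDeltaChar_cmBorel_torus_two` and `‖σ x‖ = ‖x‖` ★ `HeisRing.distribHaarChar_map_eq`).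
[cite: Rogawski1990, §11.1 p. 161; §12.1 p. 171] [cite: Casselman1995, Prop. 1.3.3] -/
theorem toFun_weylElt_mul_eq_of_isUnit_two
    (f : haveI := locallyCompactSpace_cmBorelU L 2 v
      Representation.SmoothInd (cmBorelTriple L 2 v).P
        (Representation.twist
          (((Representation.trivial ℂ ↥(torusU (conjLocal L (IsCMField.complexConj L) v) (cmLocalForm L 2 v)) ℂ).twist
            (torusCharPair (conjLocal L (IsCMField.complexConj L) v) (cmLocalForm L 2 v) (cmLocalForm_eq_over L 2 v) 0 χ₁ χ₂)).comp
            (cmBorelTriple L 2 v).proj) (rootDeltaChar (cmBorelTriple L 2 v).P)))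
    (u u' : ↥(cmBorelTriple L 2 v).N) (b : (LocalRing L v)ˣ)
    (hbu : (((u : ↥(unitaryGroupOfForm (conjLocal L (IsCMField.complexConj L) v) (cmLocalForm L 2 v))) : GL (Fin 2) (LocalRing L v)) :
      Matrix (Fin 2) (Fin 2) (LocalRing L v)) 0 1 = b)
    (h1 : (((u' : ↥(unitaryGroupOfForm (conjLocal L (IsCMField.complexConj L) v) (cmLocalForm L 2 v))) : GL (Fin 2) (LocalRing L v)) :
        Matrix (Fin 2) (Fin 2) (LocalRing L v)) 0 1 = ↑b⁻¹) :
    f.toFun (w₀ * (u : ↥(unitaryGroupOfForm (conjLocal L (IsCMField.complexConj L) v) (cmLocalForm L 2 v)))) =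
      ((((χ₁ (Units.map (conjLocal L (IsCMField.complexConj L) v : LocalRing L v →* LocalRing L v) b))⁻¹ : ℂˣ) : ℂ) *
          ((χ₂ ⟨-1, neg_one_mem_normOneUnits (conjLocal L (IsCMField.complexConj L) v)⟩ : ℂˣ) : ℂ) *
          (((halfModulusChar (LocalRing L v) b)⁻¹ : ℂˣ) : ℂ)) *
        f.toFun (w₀ * (u' : ↥(unitaryGroupOfForm (conjLocal L (IsCMField.complexConj L) v) (cmLocalForm L 2 v))) * w₀⁻¹) := by
  haveI := locallyCompactSpace_cmBorelU L 2 v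
  have hσ := conjLocal_conjLocal_cm L v
  have hJ := cmLocalForm_eq_over L 2 v
  have hU := upperFactor_mem_borelU_two (conjLocal L (IsCMField.complexConj L) v) hJ w₀ hw₀ u u' b hbu h1
  -- `σ b = −b` (the entry of `u ∈ N₂` is skew), hence `σ(b⁻¹) = −b⁻¹`
  have hσb : conjLocal L (IsCMField.complexConj L) v (b : LocalRing L v) = -(b : LocalRing L v) := by
    rw [← hbu]; exact LineRing.map_umat_zero_one_two (conjLocal L (IsCMField.complexConj L) v) hJ u
  have hbbi : (b : LocalRing L v) * ↑b⁻¹ = 1 := b.mul_inv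
  have hσbi : conjLocal L (IsCMField.complexConj L) v (↑b⁻¹ : LocalRing L v) = -(↑b⁻¹ : LocalRing L v) := by
    have h : conjLocal L (IsCMField.complexConj L) v (b : LocalRing L v) * conjLocal L (IsCMField.complexConj L) v (↑b⁻¹ : LocalRing L v) = 1 := by
      rw [← map_mul, hbbi, map_one]
    rw [hσb] at h
    linear_combination (-(↑b⁻¹ : LocalRing L v)) * h - (conjLocal L (IsCMField.complexConj L) v (↑b⁻¹ : LocalRing L v)) * hbbi
  -- `w₀ u = U · X`
  have hsplit : w₀ * (u : ↥(unitaryGroupOfForm (conjLocal L (IsCMField.complexConj L) v) (cmLocalForm L 2 v))) =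
      ((⟨_, hU⟩ : ↥(cmBorelTriple L 2 v).P) : ↥(unitaryGroupOfForm (conjLocal L (IsCMField.complexConj L) v) (cmLocalForm L 2 v))) *
        (w₀ * (u' : ↥(unitaryGroupOfForm (conjLocal L (IsCMField.complexConj L) v) (cmLocalForm L 2 v))) * w₀⁻¹) := by
    change _ = w₀ * (u : ↥(unitaryGroupOfForm (conjLocal L (IsCMField.complexConj L) v) (cmLocalForm L 2 v))) *
      (w₀ * (u' : ↥(unitaryGroupOfForm (conjLocal L (IsCMField.complexConj L) v) (cmLocalForm L 2 v))) * w₀⁻¹)⁻¹ *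
        (w₀ * (u' : ↥(unitaryGroupOfForm (conjLocal L (IsCMField.complexConj L) v) (cmLocalForm L 2 v))) * w₀⁻¹)
    rw [inv_mul_cancel_right]
  -- the entries of the Levi projection of `U`: `(proj U)₀₀ = σ(b)⁻¹`, `det (proj U) = −1`
  have hentry : torusEntry (conjLocal L (IsCMField.complexConj L) v) (cmLocalForm L 2 v) 0 ((cmBorelTriple L 2 v).proj ⟨_, hU⟩) =
      (Units.map (conjLocal L (IsCMField.complexConj L) v : LocalRing L v →* LocalRing L v) b)⁻¹ := by
    refine Units.ext ?_
    rw [coe_torusEntry_proj_borelTriple, ← map_inv, Units.coe_map, MonoidHom.coe_coe, hσbi]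
    have h0 := coe_diagEntry_zero_upperFactor_two (conjLocal L (IsCMField.complexConj L) v) hJ w₀ hw₀ u u' b hbu h1 hU
    rw [coe_diagEntry] at h0
    exact h0
  have hdet : torusDetNormOne (conjLocal L (IsCMField.complexConj L) v) (cmLocalForm L 2 v) hJ ((cmBorelTriple L 2 v).proj ⟨_, hU⟩) =
      ⟨-1, neg_one_mem_normOneUnits (conjLocal L (IsCMField.complexConj L) v)⟩ := by
    refine Subtype.ext (Units.ext ?_)
    rw [coe_torusDetNormOne, coe_torusDet, Units.val_neg, Units.val_one]
    change ((((cmBorelTriple L 2 v).proj ⟨_, hU⟩ : ↥(torusU (conjLocal L (IsCMField.complexConj L) v) (cmLocalForm L 2 v))) :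
        ↥(unitaryGroupOfForm (conjLocal L (IsCMField.complexConj L) v) (cmLocalForm L 2 v))) : GL (Fin 2) (LocalRing L v)).val.det = -1
    rw [val_proj_borelTriple, Matrix.det_diagonal, Fin.prod_univ_two]
    have h0 := coe_diagEntry_zero_upperFactor_two (conjLocal L (IsCMField.complexConj L) v) hJ w₀ hw₀ u u' b hbu h1 hU
    have h1' := coe_diagEntry_one_upperFactor_two (conjLocal L (IsCMField.complexConj L) v) hJ w₀ hw₀ u u' b hbu h1 hU
    rw [coe_diagEntry] at h0 h1'
    change ((w₀ * (u : ↥(unitaryGroupOfForm (conjLocal L (IsCMField.complexConj L) v) (cmLocalForm L 2 v))) *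
        (w₀ * (u' : ↥(unitaryGroupOfForm (conjLocal L (IsCMField.complexConj L) v) (cmLocalForm L 2 v))) * w₀⁻¹)⁻¹ :
          ↥(unitaryGroupOfForm (conjLocal L (IsCMField.complexConj L) v) (cmLocalForm L 2 v))) : GL (Fin 2) (LocalRing L v)).val 0 0 = _ at h0
    change ((w₀ * (u : ↥(unitaryGroupOfForm (conjLocal L (IsCMField.complexConj L) v) (cmLocalForm L 2 v))) *
        (w₀ * (u' : ↥(unitaryGroupOfForm (conjLocal L (IsCMField.complexConj L) v) (cmLocalForm L 2 v))) * w₀⁻¹)⁻¹ :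
          ↥(unitaryGroupOfForm (conjLocal L (IsCMField.complexConj L) v) (cmLocalForm L 2 v))) : GL (Fin 2) (LocalRing L v)).val 1 1 = _ at h1'
    change ((w₀ * (u : ↥(unitaryGroupOfForm (conjLocal L (IsCMField.complexConj L) v) (cmLocalForm L 2 v))) *
        (w₀ * (u' : ↥(unitaryGroupOfForm (conjLocal L (IsCMField.complexConj L) v) (cmLocalForm L 2 v))) * w₀⁻¹)⁻¹ :
          ↥(unitaryGroupOfForm (conjLocal L (IsCMField.complexConj L) v) (cmLocalForm L 2 v))) : GL (Fin 2) (LocalRing L v)).val 0 0 *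
      ((w₀ * (u : ↥(unitaryGroupOfForm (conjLocal L (IsCMField.complexConj L) v) (cmLocalForm L 2 v))) *
        (w₀ * (u' : ↥(unitaryGroupOfForm (conjLocal L (IsCMField.complexConj L) v) (cmLocalForm L 2 v))) * w₀⁻¹)⁻¹ :
          ↥(unitaryGroupOfForm (conjLocal L (IsCMField.complexConj L) v) (cmLocalForm L 2 v))) : GL (Fin 2) (LocalRing L v)).val 1 1 = -1
    rw [h0, h1']
    linear_combination (-1 : LocalRing L v) * hbbi
  -- `δ^{1/2}(U) = ‖U₀₀‖^{1/2} = ‖σ b‖^{-1/2} = ‖b‖^{-1/2}`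
  have hδ : rootDeltaChar (cmBorelTriple L 2 v).P ⟨_, hU⟩ = (halfModulusChar (LocalRing L v) b)⁻¹ := by
    rw [rootDeltaChar_eq_rootDeltaChar_inclusion_proj (cmBorelTriple L 2 v) (deltaChar_cmBorelTriple_eq_one_of_mem_N L 2 v) ⟨_, hU⟩]
    have h' : Subgroup.inclusion (cmBorelTriple L 2 v).M_le ((cmBorelTriple L 2 v).proj ⟨_, hU⟩) =
        ⟨(((cmBorelTriple L 2 v).proj ⟨_, hU⟩ : ↥(torusU (conjLocal L (IsCMField.complexConj L) v) (cmLocalForm L 2 v))) :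
          ↥(unitaryGroupOfForm (conjLocal L (IsCMField.complexConj L) v) (cmLocalForm L 2 v))), torusU_le_borelU _ _ ((cmBorelTriple L 2 v).proj ⟨_, hU⟩).2⟩ := rfl
    rw [h', rootDeltaChar_cmBorel_torus_two L v ((cmBorelTriple L 2 v).proj ⟨_, hU⟩), hentry, map_inv]
    -- `‖σ b‖^{1/2} = ‖b‖^{1/2}`
    congr 1
    refine Units.ext ?_
    rw [coe_halfModulusChar_apply, coe_halfModulusChar_apply]
    borelize (LocalRing L v)
    congr 3
    exact HeisRing.distribHaarChar_map_eq (conjLocal L (IsCMField.complexConj L) v) hσ (continuous_conjLocal L (IsCMField.complexConj L) v) b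
  -- evaluate
  rw [hsplit, f.toFun_subgroup_mul ⟨_, hU⟩, Representation.twist_apply, MonoidHom.comp_apply, Representation.twist_apply,
    Representation.trivial_apply, hδ, smul_smul, smul_eq_mul]
  have hχ : ((torusCharPair (conjLocal L (IsCMField.complexConj L) v) (cmLocalForm L 2 v) (cmLocalForm_eq_over L 2 v) 0 χ₁ χ₂
      ((cmBorelTriple L 2 v).proj ⟨_, hU⟩) : ℂˣ) : ℂ) =
      (((χ₁ (Units.map (conjLocal L (IsCMField.complexConj L) v : LocalRing L v →* LocalRing L v) b))⁻¹ : ℂˣ) : ℂ) *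
        ((χ₂ ⟨-1, neg_one_mem_normOneUnits (conjLocal L (IsCMField.complexConj L) v)⟩ : ℂˣ) : ℂ) := by
    rw [torusCharPair_apply, hentry, hdet, map_inv, Units.val_mul]
  rw [hχ]
  ring

end CM

end Summit.HodgeConjecture.HodgeConjecture.R90.S4

end
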